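import Summits.QuantumFields.GaugeBoot.StrongCouplingThirdOrderPieces
import Summits.QuantumFields.GaugeBoot.StrongCouplingWilsonLoops
import HarnessLib

/-!
# Strong coupling from the loop equation: the `1 × 2` Wilson loop is `O(β²)` — area two, order two (gauge-boot, ADDENDUM 25 part J)

HONEST FRAMING (cell `pub-gaugeboot`, page 1 of every file): the venture produces certified bounds
on lattice expectations at stated coupling, gauge group, dimension and torus size; NOT a mass gap,
NOT a continuum limit, NOT a string tension; NOT Yang–Mills-summit-bearing (barriers
`FixedCouplingUltralocality`, `PerturbativeInvisibility`).  A crude explicit STRONG-COUPLING bound, uniform in the volume;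
NOT an area law.

## Content (`SU(N)`, `N ≥ 2`, fundamental representation, torus `(ℤ/L)^D`, `L ≥ 3`, every real coupling)

ADDENDUM 22 (`StrongCouplingWilsonLoops`) bounds every rectangular Wilson loop by the plaquette's first-order constant,
`|⟨W̄(R×T)⟩| ≤ 4(D−1)|β_std|/(N²−1)`.  For a loop spanning area two the strong-coupling series starts at `β²`; the loop
equation sees this in one step, because every term of the loop equation of the `1 × 2` rectangle
`w = +i +j +j −i −j −j` at its first link is itself `O(β)` by the read-once bound of ADDENDUM 24:

* `edgesRead_rectangle_one_two` — the six links of `w`; `count_corner_rectangle_append` — the deformed words `w·q^{±1}`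
  (`q` any plaquette word through `(x, i)`) read the link `(x + e_i + e_j, j)` exactly once (`L ≥ 3`); the private links of
  `q` not read by `w` (`qEdge`, or `qEdge'` for the inner plaquette);
* ★★★ `abs_wilsonLoopExpectation_one_two_le` — **for `N ≥ 2`, `D ≥ 2`, every torus side `L ≥ 3` and EVERY real `β_std`:
  `|wilsonLoopExpectation N D L β_std 1 2| ≤ 16(D−1)²β_std²/(N²−1)²`** (`SU(3)`, `D = 4`: `≤ 9β_std²/4`) — the first Wilson
  loop bounded at the order of its AREA beyond the plaquette, uniformly in the volume.

References: M. Creutz, *Quarks, gluons and lattices* (1983) Ch. 10 (strong-coupling area law); K. Osterwalder, E. Seiler,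
Ann. Phys. 110 (1978) 440.  Everything is `[folklore]`.
-/

noncomputable section

open MeasureTheory Filter Topology NormedSpace
open scoped Matrix.Norms.Frobenius Matrix
open Literature.MathematicalPhysics.QuantumFieldTheory Literature.MathematicalPhysics.QuantumLattice
open Summit.QuantumFields.YangMills.Cruxes.CurvatureAmnesia.WardDefect.SchwingerDyson

namespace Summit.QuantumFields.GaugeBoot

namespace StrongCoupling

variable {d L N : ℕ}

/-! ## The `1 × 2` rectangle word and its links -/

/-- `rectangle i j 1 2 = +i +j +j −i −j −j`. [folklore] -/
theorem rectangle_one_two_eq (i j : Fin d) :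
    Word.rectangle i j 1 2 = [.fwd i, .fwd j, .fwd j, .bwd i, .bwd j, .bwd j] := by
  simp [Word.rectangle, Word.line, List.replicate]

/-- The six links of the `1 × 2` rectangle read from `x`. [folklore] -/
theorem edgesRead_rectangle_one_two (x : Site d L) (i j : Fin d) :
    Word.edgesRead x ([.fwd i, .fwd j, .fwd j, .bwd i, .bwd j, .bwd j] : Word d) =
      [(x, i), (x.shift i, j), ((x.shift i).shift j, j), ((x.shift j).shift j, i), (x.shift j, j), (x, j)] := by
  have h1 : ((x.shift i).shift j).shift j - Pi.single i 1 = (x.shift j).shift j := by simp only [Site.shift]; abel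
  have h2 : (x.shift j).shift j - Pi.single j 1 = x.shift j := by simp [Site.shift]
  have h3 : x.shift j - Pi.single j 1 = x := by simp [Site.shift]
  simp [Word.edgesRead, Step.edge, Step.apply, h1, h2, h3]

/-- In `ℤ/L` with `L ≥ 3`: `2 ≠ 0`. [folklore] -/
theorem two_ne_zero_zmod (hL : 3 ≤ L) : (2 : ZMod L) ≠ 0 := by
  have h := natCast_zmod_ne_zero (L := L) (m := 2) (by norm_num) (by omega)
  simpa using h

/-- `a − b = c ≠ 0 ⇒ a ≠ b` in `ℤ/L`. [folklore] -/
theorem zmod_ne_of_sub_eq {a b c : ZMod L} (hc : c ≠ 0) (h : a - b = c) : a ≠ b := by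
  rintro rfl; exact hc (by rw [← h, sub_self])

section Geometry

variable [NeZero L] (hL : (1 : ZMod L) ≠ 0) (h2 : (2 : ZMod L) ≠ 0) (x : Site d L) {i j : Fin d} (hij : i ≠ j)
include hL h2 hij

omit [NeZero L] h2 in
/-- The corner link `(x + e_i + e_j, j)` is none of the other five links of `w`. [folklore] -/
theorem count_corner_rectangle :
    ([(x, i), (x.shift i, j), ((x.shift i).shift j, j), ((x.shift j).shift j, i), (x.shift j, j), (x, j)] : List (Edge d L)).count
      ((x.shift i).shift j, j) = 1 := by
  have hji : j ≠ i := fun h => hij h.symm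
  have n1 : ((x.shift i).shift j, j) ≠ ((x, i) : Edge d L) := edge_ne_of_snd_ne hji
  have n2 : ((x.shift i).shift j, j) ≠ ((x.shift i, j) : Edge d L) := edge_ne_of_fst_ne (site_ne_of_apply_ne j (by
    simp only [Site.shift, Pi.add_apply, Pi.single_eq_same, Pi.single_eq_of_ne hji]
    exact zmod_ne_of_sub_eq_one hL (by ring)))
  have n4 : ((x.shift i).shift j, j) ≠ (((x.shift j).shift j, i) : Edge d L) := edge_ne_of_snd_ne hji
  have n5 : ((x.shift i).shift j, j) ≠ ((x.shift j, j) : Edge d L) := edge_ne_of_fst_ne (site_ne_of_apply_ne i (by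
    simp only [Site.shift, Pi.add_apply, Pi.single_eq_same, Pi.single_eq_of_ne hij]
    exact zmod_ne_of_sub_eq_one hL (by ring)))
  have n6 : ((x.shift i).shift j, j) ≠ ((x, j) : Edge d L) := edge_ne_of_fst_ne (site_ne_of_apply_ne i (by
    simp only [Site.shift, Pi.add_apply, Pi.single_eq_same, Pi.single_eq_of_ne hij]
    exact zmod_ne_of_sub_eq_one hL (by ring)))
  simp [n1.symm, n2.symm, n4.symm, n5.symm, n6.symm]

omit [NeZero L] in
/-- No plaquette word `q^{±1}` through `(x, i)` reads the corner link `(x + e_i + e_j, j)` (`L ≥ 3`). [folklore] -/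
theorem corner_not_mem_plaqWord {ν : Fin d} (ε : Bool) {q : Word d}
    (hq : q = plaqWord i ν ε ∨ q = (plaqWord i ν ε).reverse) : ((x.shift i).shift j, j) ∉ Word.edgesRead x q := by
  have hji : j ≠ i := fun h => hij h.symm
  -- the four links of `q^{±1}` (as a set they coincide)
  have key : ∀ e : Edge d L, e ∈ Word.edgesRead x q → e = (x, i) ∨ e = qEdge x i ν ε ∨ e = qEdge' x i ν ε ∨
      e = (if ε then (x, ν) else (x - Pi.single ν 1, ν)) := by
    intro e he
    rcases hq with rfl | rfl
    · cases ε with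
      | true =>
        rw [edgesRead_plaqWord_true] at he
        simp only [List.mem_cons, List.mem_nil_iff, or_false] at he
        simp only [qEdge_true, qEdge'_true, if_true]; tauto
      | false =>
        rw [edgesRead_plaqWord_false] at he
        simp only [List.mem_cons, List.mem_nil_iff, or_false] at he
        simp only [qEdge_false, qEdge'_false, Bool.false_eq_true, if_false]; tauto
    · cases ε with
      | true =>
        rw [edgesRead_plaqWord_true_reverse] at he
        simp only [List.mem_cons, List.mem_nil_iff, or_false] at he
        simp only [qEdge_true, qEdge'_true, if_true]; tauto
      | false =>
        rw [edgesRead_plaqWord_false_reverse] at he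
        simp only [List.mem_cons, List.mem_nil_iff, or_false] at he
        simp only [qEdge_false, qEdge'_false, Bool.false_eq_true, if_false]; tauto
  intro hmem
  rcases key _ hmem with h | h | h | h
  · exact edge_ne_of_snd_ne hji h
  · cases ε with
    | true =>
      rw [qEdge_true] at h
      by_cases hνj : ν = j
      · subst hνj
        exact edge_ne_of_fst_ne (site_ne_of_apply_ne ν (by
          simp only [Site.shift, Pi.add_apply, Pi.single_eq_same, Pi.single_eq_of_ne hji]
          exact zmod_ne_of_sub_eq_one hL (by ring))) h
      · exact edge_ne_of_snd_ne (fun e => hνj e.symm) h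
    | false =>
      rw [qEdge_false] at h
      by_cases hνj : ν = j
      · subst hνj
        exact edge_ne_of_fst_ne (site_ne_of_apply_ne ν (by
          simp only [Site.shift, Pi.add_apply, Pi.sub_apply, Pi.single_eq_same, Pi.single_eq_of_ne hji]
          exact zmod_ne_of_sub_eq h2 (by ring))) h
      · exact edge_ne_of_snd_ne (fun e => hνj e.symm) h
  · cases ε with
    | true => rw [qEdge'_true] at h; exact edge_ne_of_snd_ne hji h
    | false => rw [qEdge'_false] at h; exact edge_ne_of_snd_ne hji h
  · cases ε with
    | true =>
      simp only [if_true] at h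
      by_cases hνj : ν = j
      · subst hνj
        exact edge_ne_of_fst_ne (site_ne_of_apply_ne i (by
          simp only [Site.shift, Pi.add_apply, Pi.single_eq_same, Pi.single_eq_of_ne hij]
          exact zmod_ne_of_sub_eq_one hL (by ring))) h
      · exact edge_ne_of_snd_ne (fun e => hνj e.symm) h
    | false =>
      simp only [Bool.false_eq_true, if_false] at h
      by_cases hνj : ν = j
      · subst hνj
        exact edge_ne_of_fst_ne (site_ne_of_apply_ne i (by
          simp only [Site.shift, Pi.add_apply, Pi.sub_apply, Pi.single_eq_same, Pi.single_eq_of_ne hij]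
          exact zmod_ne_of_sub_eq_one hL (by ring))) h
      · exact edge_ne_of_snd_ne (fun e => hνj e.symm) h

omit [NeZero L] in
/-- ★ **The deformed rectangle `w·q^{±1}` reads the corner link exactly once** (`L ≥ 3`). [folklore] -/
theorem count_corner_rectangle_append {ν : Fin d} (ε : Bool) {q : Word d}
    (hq : q = plaqWord i ν ε ∨ q = (plaqWord i ν ε).reverse) :
    (Word.edgesRead x (([.fwd i, .fwd j, .fwd j, .bwd i, .bwd j, .bwd j] : Word d) ++ q)).count ((x.shift i).shift j, j) = 1 := by
  have hend : Word.endpoint x ([.fwd i, .fwd j, .fwd j, .bwd i, .bwd j, .bwd j] : Word d) = x := by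
    rw [← rectangle_one_two_eq]; exact Word.endpoint_rectangle x i j 1 2
  rw [Word.edgesRead_append, hend, List.count_append, edgesRead_rectangle_one_two, count_corner_rectangle hL x hij,
    List.count_eq_zero_of_not_mem (corner_not_mem_plaqWord hL h2 x hij ε hq)]

/-- **A private link of `q` not read by `w`**: for `q` the inner plaquette `plaqWord i j +` the link `qEdge' = (x + e_j, i)`,
otherwise `qEdge`. [folklore] -/
theorem private_not_mem_rectangle {ν : Fin d} (hνi : ν ≠ i) (ε : Bool) :
    (if ν = j ∧ ε = true then qEdge' x i ν ε else qEdge x i ν ε) ∉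
      Word.edgesRead x ([.fwd i, .fwd j, .fwd j, .bwd i, .bwd j, .bwd j] : Word d) := by
  have hji : j ≠ i := fun h => hij h.symm
  rw [edgesRead_rectangle_one_two]
  by_cases hc : ν = j ∧ ε = true
  · obtain ⟨rfl, rfl⟩ := hc
    simp only [and_self, if_true, qEdge'_true]
    refine List.not_mem_cons_of_ne_of_not_mem (edge_ne_of_fst_ne (shift_ne_self hL x ν)) (List.not_mem_cons_of_ne_of_not_mem
      (edge_ne_of_snd_ne hij) (List.not_mem_cons_of_ne_of_not_mem (edge_ne_of_snd_ne hij)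
      (List.not_mem_cons_of_ne_of_not_mem ?_ (List.not_mem_cons_of_ne_of_not_mem (edge_ne_of_snd_ne hij)
      (List.not_mem_cons_of_ne_of_not_mem (edge_ne_of_snd_ne hij) (List.not_mem_nil))))))
    exact edge_ne_of_fst_ne (site_ne_of_apply_ne ν (by
      simp only [Site.shift, Pi.add_apply, Pi.single_eq_same]
      exact fun h => hL (by linear_combination -h)))
  · simp only [hc, if_false]
    by_cases hνj : ν = j
    · subst hνj
      have hε : ε = false := by
        cases ε
        · rfl
        · exact absurd ⟨rfl, rfl⟩ hc
      subst hε
      rw [qEdge_false]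
      refine List.not_mem_cons_of_ne_of_not_mem (edge_ne_of_snd_ne hνi) (List.not_mem_cons_of_ne_of_not_mem ?_
        (List.not_mem_cons_of_ne_of_not_mem ?_ (List.not_mem_cons_of_ne_of_not_mem (edge_ne_of_snd_ne hνi)
        (List.not_mem_cons_of_ne_of_not_mem ?_ (List.not_mem_cons_of_ne_of_not_mem ?_ (List.not_mem_nil))))))
      · exact edge_ne_of_fst_ne (site_ne_of_apply_ne ν (by
          simp only [Site.shift, Pi.add_apply, Pi.sub_apply, Pi.single_eq_same, Pi.single_eq_of_ne hνi]
          exact zmod_ne_of_sub_eq (neg_ne_zero.2 hL) (by ring)))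
      · exact edge_ne_of_fst_ne (site_ne_of_apply_ne ν (by
          simp only [Site.shift, Pi.add_apply, Pi.sub_apply, Pi.single_eq_same, Pi.single_eq_of_ne hνi]
          exact zmod_ne_of_sub_eq (neg_ne_zero.2 h2) (by ring)))
      · exact edge_ne_of_fst_ne (site_ne_of_apply_ne i (by
          simp only [Site.shift, Pi.add_apply, Pi.sub_apply, Pi.single_eq_same, Pi.single_eq_of_ne hij]
          exact zmod_ne_of_sub_eq_one hL (by ring)))
      · exact edge_ne_of_fst_ne (site_ne_of_apply_ne i (by
          simp only [Site.shift, Pi.add_apply, Pi.sub_apply, Pi.single_eq_same, Pi.single_eq_of_ne hij]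
          exact zmod_ne_of_sub_eq_one hL (by ring)))
    · -- axis `ν ∉ {i, j}`
      have hax : ∀ ε, (qEdge x i ν ε).2 = ν := fun ε => by cases ε <;> rfl
      intro hmem
      have : (qEdge x i ν ε).2 ∈ ({i, j} : Finset (Fin d)) := by
        simp only [List.mem_cons, List.mem_nil_iff, or_false] at hmem
        rcases hmem with h | h | h | h | h | h <;> simp [h]
      rw [hax] at this
      simp only [Finset.mem_insert, Finset.mem_singleton] at this
      exact this.elim hνi hνj

end Geometry

/-! ## The bound -/

/-- ★★★ **THE `1 × 2` WILSON LOOP IS `O(β²)` AT STRONG COUPLING, EXPLICITLY.**  For `SU(N)`, `N ≥ 2`, `D ≥ 2`, every torus side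
`L ≥ 3` and EVERY real standard coupling `β_std`: `|wilsonLoopExpectation N D L β_std 1 2| ≤ 16(D−1)²β_std²/(N²−1)²` — one
loop-equation step at the first link of the rectangle, every term of which is `O(β)` by the read-once bound. [folklore] -/
theorem abs_wilsonLoopExpectation_one_two_le {N D L : ℕ} [NeZero L] (hN : 2 ≤ N) (hD : 2 ≤ D) (hL : 3 ≤ L) (β : ℝ) :
    |wilsonLoopExpectation N D L β 1 2| ≤ 16 * ((D : ℝ) - 1) ^ 2 * β ^ 2 / ((N : ℝ) ^ 2 - 1) ^ 2 := by
  obtain ⟨i, j, hij⟩ : ∃ i j : Fin D, i ≠ j := ⟨⟨0, by omega⟩, ⟨1, by omega⟩, by simp [Fin.ext_iff]⟩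
  have hL1 : (1 : ZMod L) ≠ 0 := zmod_one_ne_zero (by omega)
  have hL2 : (2 : ZMod L) ≠ 0 := two_ne_zero_zmod hL
  have hN2 : (2 : ℝ) ≤ N := by exact_mod_cast hN
  have hNpos : (0 : ℝ) < N := by linarith
  have hN21 : (0 : ℝ) < (N : ℝ) ^ 2 - 1 := by nlinarith
  have hd1 : (0 : ℝ) ≤ (D : ℝ) - 1 := sub_one_nonneg_of_axis i
  set x : Site D L := fun _ => 0 with hx
  set w : Word D := [.fwd i, .fwd j, .fwd j, .bwd i, .bwd j, .bwd j] with hw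
  have hwx : Word.endpoint x w = x := by rw [hw, ← rectangle_one_two_eq]; exact Word.endpoint_rectangle x i j 1 2
  -- the loop equation of `w` at `(x, i)` (tree coupling `β/N`)
  have hsplit : ∀ U : GaugeConfig D L (Matrix.specialUnitaryGroup (Fin N) ℂ),
      ∑ k ∈ Finset.range w.length, splitTerm (fundamentalRep (Fin N)) 1 x i U w k =
        ((N : ℂ) - 1 / N) * (fundamentalRep (Fin N) (wordHolonomy U x w)).trace := fun U => by
    have h := sum_splitTerm_cons_fwd (fundamentalRep (Fin N)) 1 x i U (avoids_rectangle_tail x hij (R := 0) (T := 2)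
      (by omega) (by norm_num) (by omega))
    rw [← rectangle_succ_eq, rectangle_one_two_eq] at h
    exact h
  have heq := coeff_mul_integral_trace_eq (d := D) (L := L) (fundamentalLatticeRep N) (β / N) x i 1 w hwx hsplit
    (fun a b => sdPair_specialUnitaryGroup N _ x i x w _ (trace_unitDir_one a b))
  simp only [integral_plaqTerm_latticeRep (fundamentalLatticeRep N)] at heq
  simp only [fundamentalLatticeRep_N, fundamentalLatticeRep_ρ] at heq
  have heq' : ((N : ℂ) - 1 / N) * (∫ U, (fundamentalRep (Fin N) (wordHolonomy U x w)).trace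
      ∂(wilsonMeasure (d := D) (L := L) (fundamentalRep (Fin N)) (β / N))) =
      -(((β / N : ℝ) : ℂ) / 2 * ∑ ν ∈ Finset.univ.erase i, ∑ ε : Bool,
        ((∫ U, (fundamentalRep (Fin N) (wordHolonomy U x (w ++ plaqWord i ν ε))).trace
            ∂(wilsonMeasure (d := D) (L := L) (fundamentalRep (Fin N)) (β / N))) -
          (∫ U, (fundamentalRep (Fin N) (wordHolonomy U x (w ++ (plaqWord i ν ε).reverse))).trace
            ∂(wilsonMeasure (d := D) (L := L) (fundamentalRep (Fin N)) (β / N))) -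
          1 / (N : ℂ) * ((∫ U, (fundamentalRep (Fin N) (wordHolonomy U x w)).trace *
              (fundamentalRep (Fin N) (wordHolonomy U x (plaqWord i ν ε))).trace
                ∂(wilsonMeasure (d := D) (L := L) (fundamentalRep (Fin N)) (β / N))) -
            (∫ U, (fundamentalRep (Fin N) (wordHolonomy U x w)).trace *
              (fundamentalRep (Fin N) (wordHolonomy U x (plaqWord i ν ε).reverse)).trace
                ∂(wilsonMeasure (d := D) (L := L) (fundamentalRep (Fin N)) (β / N)))))) := heq
  -- every term is `O(β)`
  set C₀ : ℝ := 4 * ((D : ℝ) - 1) * (N : ℝ) ^ 2 * |β / N| / ((N : ℝ) ^ 2 - 1) with hC₀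
  have hterm : ∀ ν ∈ Finset.univ.erase i, ∀ ε : Bool,
      ‖(∫ U, (fundamentalRep (Fin N) (wordHolonomy U x (w ++ plaqWord i ν ε))).trace
          ∂(wilsonMeasure (d := D) (L := L) (fundamentalRep (Fin N)) (β / N))) -
        (∫ U, (fundamentalRep (Fin N) (wordHolonomy U x (w ++ (plaqWord i ν ε).reverse))).trace
          ∂(wilsonMeasure (d := D) (L := L) (fundamentalRep (Fin N)) (β / N))) -
        1 / (N : ℂ) * ((∫ U, (fundamentalRep (Fin N) (wordHolonomy U x w)).trace *
            (fundamentalRep (Fin N) (wordHolonomy U x (plaqWord i ν ε))).trace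
              ∂(wilsonMeasure (d := D) (L := L) (fundamentalRep (Fin N)) (β / N))) -
          (∫ U, (fundamentalRep (Fin N) (wordHolonomy U x w)).trace *
            (fundamentalRep (Fin N) (wordHolonomy U x (plaqWord i ν ε).reverse)).trace
              ∂(wilsonMeasure (d := D) (L := L) (fundamentalRep (Fin N)) (β / N))))‖ ≤ 2 * C₀ + 1 / N * (2 * (C₀ * N)) := by
    intro ν hν ε
    have hνi : ν ≠ i := (Finset.mem_erase.1 hν).1
    have hA : ∀ {q : Word D} (hq : q = plaqWord i ν ε ∨ q = (plaqWord i ν ε).reverse),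
        ‖∫ U, (fundamentalRep (Fin N) (wordHolonomy U x (w ++ q))).trace
          ∂(wilsonMeasure (d := D) (L := L) (fundamentalRep (Fin N)) (β / N))‖ ≤ C₀ := fun hq => by
      have h := readOnce_suN (d := D) (L := L) hN (β / N) x (w ++ _) (by rw [Word.endpoint_append, hwx, endpoint_qw x ε hq])
        _ (count_corner_rectangle_append hL1 hL2 x hij ε hq) (mulData_one (e := ((x.shift i).shift j, j)))
      simp only [mul_one] at h
      exact h
    have hB : ∀ {q : Word D} (hq : q = plaqWord i ν ε ∨ q = (plaqWord i ν ε).reverse),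
        ‖∫ U, (fundamentalRep (Fin N) (wordHolonomy U x w)).trace * (fundamentalRep (Fin N) (wordHolonomy U x q)).trace
          ∂(wilsonMeasure (d := D) (L := L) (fundamentalRep (Fin N)) (β / N))‖ ≤ C₀ * N := fun {q} hq => by
      have hsw : ∀ U : GaugeConfig D L (Matrix.specialUnitaryGroup (Fin N) ℂ),
          (fundamentalRep (Fin N) (wordHolonomy U x w)).trace * (fundamentalRep (Fin N) (wordHolonomy U x q)).trace =
            (fundamentalRep (Fin N) (wordHolonomy U x q)).trace * (fundamentalRep (Fin N) (wordHolonomy U x w)).trace :=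
        fun U => mul_comm _ _
      simp_rw [hsw]
      have hpriv := private_not_mem_rectangle hL1 hL2 x hij hνi ε
      by_cases hc : ν = j ∧ ε = true
      · rw [if_pos hc] at hpriv
        obtain ⟨rfl, rfl⟩ := hc
        have h := readOnce_suN (d := D) (L := L) hN (β / N) x q (endpoint_qw x true hq) _ (count_qEdge'_eq_one hL1 x hνi true hq)
          (mulData_trace x w hpriv)
        refine h.trans (le_of_eq ?_)
        rw [hC₀]; ring
      · rw [if_neg hc] at hpriv
        have h := readOnce_suN (d := D) (L := L) hN (β / N) x q (endpoint_qw x ε hq) _ (count_qEdge_eq_one hL1 x hνi ε hq)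
          (mulData_trace x w hpriv)
        refine h.trans (le_of_eq ?_)
        rw [hC₀]; ring
    exact norm_four_piece_le (hA (Or.inl rfl)) (hA (Or.inr rfl)) (hB (Or.inl rfl)) (hB (Or.inr rfl))
  have hS := norm_sum_sum_le_of_le hterm
  have h4 : 2 * C₀ + 1 / N * (2 * (C₀ * N)) = 4 * C₀ := by field_simp; ring
  rw [h4] at hS
  rw [coeff_cast hN] at heq'
  have hmain := norm_le_of_coeff_mul_eq (coeff_pos hN) heq' hS
  -- `wilsonLoopExpectation = (1/N) Re E tr hol w`
  have hW := wilsonExpectation_wordLoop_eq_re_integral_latticeRep (d := D) (L := L) (fundamentalLatticeRep N) (β / N) x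
    (Word.rectangle i j 1 2)
  simp only [fundamentalLatticeRep_N, fundamentalLatticeRep_ρ] at hW
  have hW' : wilsonExpectation (suRep N) (β / N) (wordLoop (suRep N) x (Word.rectangle i j 1 2)) =
      (N : ℝ)⁻¹ * (∫ U, (fundamentalRep (Fin N) (wordHolonomy U x w)).trace
        ∂(wilsonMeasure (d := D) (L := L) (fundamentalRep (Fin N)) (β / N))).re := by
    rw [hw, ← rectangle_one_two_eq]; exact hW
  rw [wilsonLoopExpectation_eq_wordLoop N D L β 1 2 x hij, hW', abs_mul, abs_inv, Nat.abs_cast]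
  have hre := Complex.abs_re_le_norm (∫ U, (fundamentalRep (Fin N) (wordHolonomy U x w)).trace
    ∂(wilsonMeasure (d := D) (L := L) (fundamentalRep (Fin N)) (β / N)))
  refine (mul_le_mul_of_nonneg_left (hre.trans hmain) (inv_nonneg.2 hNpos.le)).trans (le_of_eq ?_)
  rw [hC₀, abs_div, Nat.abs_cast, ← sq_abs β]
  field_simp
  ring

/-- `SU(3)`, `D = 4`: `|wilsonLoopExpectation 3 4 L β 1 2| ≤ 9β²/4` for every `L ≥ 3` and every real `β`. [folklore] -/
theorem abs_wilsonLoopExpectation_one_two_three_four_le {L : ℕ} [NeZero L] (hL : 3 ≤ L) (β : ℝ) :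
    |wilsonLoopExpectation 3 4 L β 1 2| ≤ 9 * β ^ 2 / 4 := by
  have h := abs_wilsonLoopExpectation_one_two_le (N := 3) (D := 4) (L := L) (by norm_num) (by norm_num) hL β
  norm_num at h
  linarith

end StrongCoupling

end Summit.QuantumFields.GaugeBoot

end
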